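/-
Copyright (c) 2026. All rights reserved.
Released under Apache 2.0 license as described in the file LICENSE.
Authors: abc-iut cell — seat abc-iut-f-068 (block F fact-proving wave; consistency companion of the schema
refutations for FACT-LIST rows F-0290, F-0292 of `EllipticCuspidalizationComparison.lean`).
-/
import Literature.AnabelianGeometry.AbsoluteAnabelian.AbsTopII.EllipticCuspidalizationComparison
import Literature.AnabelianGeometry.AbsoluteAnabelian.SubpadicSlimProofs
import Literature.AnabelianGeometry.AbsoluteAnabelian.SubpadicExamples
import Literature.AnabelianGeometry.AbsoluteAnabelian.AbsTopIII.KummerFaithfulSubpadicProofs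
import Literature.AnabelianGeometry.AbsoluteAnabelian.SlimTransport
import Literature.AnabelianGeometry.SemiGraphs.WitnessIwahoriGroup
import HarnessLib

/-!
# [AbsTopII] Cor 3.3 (ii) / Cor 3.4 over a class `𝒟`: the schemata `EllipticModel.Cor_3_3_ii`,
# `EllipticModel.Cor_3_4` are CONSISTENT with inhabited hypotheses (kernel models)

S. Mochizuki, *Topics in Absolute Anabelian Geometry II*, Cor 3.3 pp. 67–69, Cor 3.4 pp. 69–70 (bib key
`MochizukiAbsTopII2013`).  PROOF-ONLY companion of `AbsTopII/EllipticCuspidalizationComparison.lean`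
(no `def`/`instance`/`structure`).  The universal closures over `(𝒟, M)` of the typed schemata are
FALSE (`EllipticModel.not_forall_cor_3_4`, abc-iut-f-068, `EllipticComparisonClosures.lean`;
`EllipticModel.not_forall_cor_3_3_ii`, abc-iut-f-067, `EllipticCuspidalizationComparisonSchemaRefuted.lean`,
FACT-LIST rows F-0292 / F-0290).  This file records the complementary half of "SCHEMA, consumed per
instance": each of the two statements also HOLDS at a model in which the `𝒟`-hypotheses hold and the
standing hypotheses `IsCor33Member` ARE inhabited (so neither truth value is an artefact of vacuity or of
an inconsistency of the interface) — `exists_models_cor_3_4_and_cor_3_3_ii`.  The class is the one of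
the refutations: the GENUINE field `ℚ_p` (`G_{ℚ_p}` slim — `IsSubpadicFor.isSlimGroup_absoluteGaloisGroup`;
`χ_p` open — `IsSubpadic.isOpen_range_cyclotomicChar`; tree theorems), one member
`Π := P × G_{ℚ_p} ↠ G_{ℚ_p}` with `Δ = P := ℤ_p ⋊ (1 + pℤ_p)` (`Iw p`, slim), `Σ` = all primes, scheme
isomorphisms := outer isomorphisms (rel-isom-DGC tautological), no chain terms (chain-full).  The model
for Cor 3.4: one setting with "`Π_{U_X} ↠ Π`" the identity (so `φ_U := φ`, unique on the nose); the model
for Cor 3.3 (ii): no settings and "double coverings" := the REAL right-hand side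
`semiEllipticDoubleCoverSubgroups` of the `k`-core `:= X`.

HONEST FRAMING: junk model data over a genuine base field; statements about the cell's interface typing
only (independence of the two schema rows from the interface axioms); nothing about the published
Corollaries, nothing bearing on [IUTchIII] Cor 3.12; no side taken; typed ≠ proved.
-/

noncomputable section

open CategoryTheory Topology

namespace Literature.AnabelianGeometry.AbsoluteAnabelian.AbsTopII

open Literature.AlgebraicGeometry.Frobenioids (IsSlimGroup)
open Literature.AnabelianGeometry.SemiGraphs (Iw)
open FundamentalExtension AugmentedProfiniteGrp
open AbsTopI (ConstructionDataClass)

namespace EllipticModel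

/-- **`EllipticModel.Cor_3_4` and `EllipticModel.Cor_3_3_ii` are satisfiable together with their
hypotheses**: over the class of the genuine field `ℚ_p` (chain-full, rel-isom-DGC) with the member
`Π = (ℤ_p ⋊ (1 + pℤ_p)) × G_{ℚ_p}` satisfying the standing hypotheses of Cor 3.3 / 3.4, (a) the model
with one setting and `Π_{U_X} ↠ Π := id` satisfies `Cor_3_4` (`φ_U := φ`; any `φ_U` over `φ` equals `φ`),
and (b) the model with no settings and `doubleCovers := semiEllipticDoubleCoverSubgroups` of the
`k`-core `:= X` satisfies `Cor_3_3_ii` (by definition).  Together with `not_forall_cor_3_4` /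
`not_forall_cor_3_3_ii`: both rows are independent of the interface axioms — schemata to be consumed at
the intended instance. [cite: MochizukiAbsTopII2013, Cor 3.4 pp.69-70] -/
theorem exists_models_cor_3_4_and_cor_3_3_ii (p : ℕ) [Fact p.Prime] :
    ∃ (𝒟 : ConstructionDataClass.{0}) (b : 𝒟.Base) (X : (𝒟.datum b).Obj),
      𝒟.IsChainFull ∧ 𝒟.RelIsomDGC ∧
        (∃ M : EllipticModel 𝒟, M.IsCor33Member b X ∧ Nonempty (M.Setting b X) ∧ M.Cor_3_4) ∧
        ∃ M : EllipticModel 𝒟, M.IsCor33Member b X ∧ M.Cor_3_3_ii := by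
  -- the genuine base field `ℚ_p`: `G = G_{ℚ_p}` is slim and `χ_p` has open image (tree theorems)
  let G : ProfiniteGrp.{0} := absoluteGaloisGrp ℚ_[p]
  have hG : IsSlimGroup G :=
    IsSubpadicFor.isSlimGroup_absoluteGaloisGroup (AbsTopIII.IsSubpadicFor.padic p)
  have hsub : AbsTopIII.IsSubpadic ℚ_[p] := ⟨⟨p, inferInstance, AbsTopIII.IsSubpadicFor.padic p⟩⟩
  have hχ : IsOpen (Set.range (AbsTopIII.cyclotomicChar ℚ_[p] p)) :=
    hsub.isOpen_range_cyclotomicChar p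
  -- `Δ := P = ℤ_p ⋊ (1 + pℤ_p)` (slim, nontrivial), `Π := P × G ↠ G`
  let P : Type := Iw p
  have hPslim : IsSlimGroup P := ⟨Literature.AnabelianGeometry.SemiGraphs.Iw.centralizer_eq_bot_of_isOpen⟩
  let A : AugmentedProfiniteGrp G :=
    { arith := ProfiniteGrp.of (P × G)
      aug := ContinuousMonoidHom.snd P G
      aug_surjective := fun g => ⟨(1, g), rfl⟩ }
  -- the datum, the class, the (empty) cuspidal data, the model
  let D : RelativeAnabelianDatum G :=
    { Obj := PUnit.{1}, Hom := fun _ _ => A.OuterHom A, IsIso := fun c => c.IsIso,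
      IsHyperbolicCurve := fun _ => True, primes := Set.univ, grp := fun _ => A,
      outerHom := fun c => c }
  let 𝒟 : ConstructionDataClass.{0} :=
    { Base := PUnit.{1}, fld := fun _ => ℚ_[p], instField := fun _ => inferInstance,
      instCharZero := fun _ => inferInstance, datum := fun _ => D, Mem := fun _ _ => True,
      IsHyperbolicOrbicurve := fun _ _ => True,
      isHyperbolicOrbicurve_of_isHyperbolicCurve := fun _ _ _ => trivial,
      chainTerms := fun _ _ => ∅ }
  let noCusps : ∀ E' : FundamentalExtension.{0}, CuspidalData E' := fun E' =>
    { Cusp := PEmpty.{1}, Dcusp := fun x => x.elim, Icusp := fun x => x.elim,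
      Icusp_eq := fun x => x.elim, isClosed_Dcusp := fun x => x.elim,
      eq_of_conj := fun x => x.elim }
  let M : EllipticModel 𝒟 :=
    { cusps := fun _ _ => noCusps _
      IsEllipticallyAdmissible := fun _ _ => True
      coreExt := fun b X => (𝒟.datum b).ext X
      toCore := fun _ _ => 𝟙 _
      toCore_isOpenInjective := fun _ _ => Hom.IsOpenInjective.id _
      toCore_gal_bijective := fun _ _ => Function.bijective_id
      doubleCovers := fun _ _ => Set.univ
      Setting := fun _ _ => PUnit.{1}
      PiD := fun _ => ⊤, PiD_mem := fun _ => Set.mem_univ _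
      galOpen := fun _ => ⊤, normal_galOpen := fun _ => inferInstance
      isOpen_galOpen := fun _ => isOpen_univ
      level := fun _ => 1
      level_isSigmaInteger := fun _ => ⟨Nat.one_pos, fun q _ _ => Set.mem_univ q⟩
      PiV := fun _ => ⊤, normal_PiV := fun _ => inferInstance, isOpen_PiV := fun _ => isOpen_univ
      PiV_le := fun _ _ _ => Subgroup.mem_comap.mpr (Subgroup.mem_top _)
      map_PiV_le := fun _ => le_top
      cuspUX := fun _ => ⟨_, 𝟙 _, Function.surjective_id, Function.bijective_id⟩
      proSet_geom_cuspUX := fun _ => ⟨fun _ _ _ q _ _ => Set.mem_univ q⟩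
      cuspsUX := fun _ => noCusps _ }
  -- `Δ = P × 1` is slim (transport from `P`) and nontrivial
  have hΔ : IsSlimGroup ((𝒟.datum PUnit.unit).ext PUnit.unit).geom := by
    refine isSlimGroup_of_continuousMulEquiv (G := P) ?_ hPslim
    exact
      { toFun := fun x => ⟨(x, 1), rfl⟩
        invFun := fun y => y.1.1
        left_inv := fun _ => rfl
        right_inv := fun y => Subtype.ext (Prod.ext rfl y.2.symm)
        map_mul' := fun _ _ => Subtype.ext (Prod.ext rfl (one_mul 1).symm)
        continuous_toFun := (continuous_id.prodMk continuous_const).subtype_mk _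
        continuous_invFun := continuous_fst.comp continuous_subtype_val }
  have hne : ((𝒟.datum PUnit.unit).ext PUnit.unit).geom ≠ ⊥ := by
    intro h
    let x : ((𝒟.datum PUnit.unit).ext PUnit.unit).arith := ((⟨1, 0⟩ : Iw p), (1 : G))
    have hx : x ∈ ((𝒟.datum PUnit.unit).ext PUnit.unit).geom := rfl
    have hx1 : x = 1 := (Subgroup.eq_bot_iff_forall _).mp h x hx
    have ha := congrArg (fun y : ((𝒟.datum PUnit.unit).ext PUnit.unit).arith => (y.1 : Iw p).a) hx1
    change (1 : ℤ_[p]) = 0 at ha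
    exact one_ne_zero ha
  -- (a) Cor 3.4 holds at `M`: `Π_{U_X} ↠ Π` is the identity for the unique setting
  have h34 : M.Cor_3_4 := by
    intro _ _ b₁ b₂ X₁ X₂ _ _ s₁ s₂ _ _ _ φ _
    refine ⟨⟨φ, fun x => rfl⟩, fun φU φU' h h' => ⟨1, rfl, fun x => ?_⟩⟩
    have hx : φU x = φ x := h x
    have hx' : φU' x = φ x := h' x
    rw [hx', one_mul, inv_one, mul_one, hx]
  -- (b) the model with no settings and the REAL right-hand side as "double coverings"
  let M₂ : EllipticModel 𝒟 :=
    { M with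
      doubleCovers := fun b X => semiEllipticDoubleCoverSubgroups ((𝒟.datum b).ext X)
      Setting := fun _ _ => PEmpty.{1}
      PiD := fun s => s.elim, PiD_mem := fun s => s.elim
      galOpen := fun s => s.elim, normal_galOpen := fun s => s.elim, isOpen_galOpen := fun s => s.elim
      level := fun s => s.elim, level_isSigmaInteger := fun s => s.elim
      PiV := fun s => s.elim, normal_PiV := fun s => s.elim, isOpen_PiV := fun s => s.elim
      PiV_le := fun s => s.elim, map_PiV_le := fun s => s.elim
      cuspUX := fun s => s.elim, proSet_geom_cuspUX := fun s => s.elim, cuspsUX := fun s => s.elim }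
  refine ⟨𝒟, PUnit.unit, PUnit.unit,
    fun _ _ _ t ht => ((Set.mem_empty_iff_false t).mp ht).elim, fun _ _ _ _ _ => Set.bijOn_id _,
    ⟨M,
      { mem := trivial, ellipticallyAdmissible := trivial, slim := hG,
        cyclotomic := ⟨p, inferInstance, Set.mem_univ p, hχ⟩, geom_slim := hΔ, geom_ne_bot := hne },
      ⟨PUnit.unit⟩, h34⟩,
    ⟨M₂,
      { mem := trivial, ellipticallyAdmissible := trivial, slim := hG,
        cyclotomic := ⟨p, inferInstance, Set.mem_univ p, hχ⟩, geom_slim := hΔ, geom_ne_bot := hne },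
      fun _ _ _ _ _ => rfl⟩⟩

end EllipticModel

end Literature.AnabelianGeometry.AbsoluteAnabelian.AbsTopII
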